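import Summits.QuantumAdvantage.QuantumAdvantage.Theses.WhiteBoxWalk
import Literature.Computability.Complexity.PlumbingBricks
import Literature.Computability.Complexity.StringEquality
import Literature.Computability.Complexity.PairingMachines
import Literature.Computability.Complexity.RandomizedProofs
import Literature.Computability.Complexity.TimeBoundsProofs
import Literature.Computability.Complexity.BPPErrorReduction

/-!
# Route `WhiteBoxWalk`, crux `WbwThesis` (stmt-QuantumAdvantage-2238), line `Sketch`: the generic bridge

`stub_bridge`: a one-way function `gen` together with a map `pre` giving, for every seed `s`, a
`gen`-preimage of `gen s` of the seed's length (`gen (pre s) = gen s`, `|pre s| = |s| ≤ |gen s|`)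
which ONE uniform oracle-free Clifford+T family outputs from `gen s` (zero-padded to `|gen s|`, as
a prefix of the measured wires, with probability `≥ 2/3`) witnesses `WbwThesis`, with
`ans s := pre s ++ 0^{|gen s| - |s|}`:

* `gen ∈ FP` is half of one-wayness, and `|ans s| = |s| + (|gen s| - |s|) = |gen s| = X(|gen s|)`;
* clause (Q) is the hypothesis verbatim;
* clause (C): fix a PPT `A`.  The TRUNCATION ADVERSARY `B` runs `A` with the same coins on the same
  input `⟨u, y⟩` and keeps the first `|u|` output symbols (on `⟨1ⁿ, gen s⟩`: the first `n`).  It is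
  PPT (its run map on the pair presentation is the brick
  `takeFn ∘ fanoutFn (fstF ∘ fstF) (uncurry A.run ∘ boolUnpair)`), and seed by seed, coin string by
  coin string, if `A` prints a string with prefix `ans s` then `B` prints `pre s`, a `gen`-preimage
  of `gen s`; hence `A`'s average success at length `n` is at most `invertProb gen B n`, which is
  negligible because `gen` is one-way.

No new definitions: the adversary is an anonymous `RandAlg`, characterised by its run map; the
helper lemmas live in the sub-namespace `Bridge`.
-/

noncomputable section

set_option linter.dupNamespace false

namespace Summit.QuantumAdvantage.QuantumAdvantage.Theorems.WhiteBoxWalk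

open Literature.Computability.Cryptography Literature.Computability.Complexity
open Literature.Computability.Complexity.Brick (fstF fstF_boolPair fstF_mem_FP)
open Literature.Computability.Complexity.Plumb (takeFn takeFn_boolPair takeFn_mem_FP)
open _root_.Computability Polynomial Filter Asymptotics

namespace Bridge

/-- **The truncation adversary is PPT.** If `B` runs `A` with the same coins and keeps the first
`|fstF z|` output symbols (`B.run z r = A(z; r) ↾ |fstF z|`, coin budget `A`'s), then `B` is PPT when
`A` is: on the pair presentation `⟨z, r⟩` its run map is the brick
`takeFn ∘ fanoutFn (fstF ∘ fstF) (uncurry A.run ∘ boolUnpair) ∈ FP`, transported by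
`PolyTimeComputable.of_encode_eq`. [folklore] -/
theorem isPPT_of_run_eq_take {A B : RandAlg (List Bool) (List Bool)} (hA : IsPPT A id)
    (hrun : ∀ z r, B.run z r = (A.run z r).take (fstF z).length) (hcoin : B.coinLen = A.coinLen) :
    IsPPT B id := by
  have hFA : (Function.uncurry A.run ∘ boolUnpair) ∈ FP :=
    PolyTimeComputable.comp_holds hA.1 polyTimeComputable_boolUnpair
  have hG : takeFn ∘ fanoutFn (fstF ∘ fstF) (Function.uncurry A.run ∘ boolUnpair) ∈ FP :=
    comp_mem_FP takeFn_mem_FP (fanoutFn_mem_FP (comp_mem_FP fstF_mem_FP fstF_mem_FP) hFA)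
  obtain ⟨p, hp⟩ := hA.2
  refine ⟨?_, p, fun n => by rw [hcoin]; exact hp n⟩
  refine PolyTimeComputable.of_encode_eq (ea := id) (eb := id)
    (f := takeFn ∘ fanoutFn (fstF ∘ fstF) (Function.uncurry A.run ∘ boolUnpair))
    (fun q : List Bool × List Bool => boolPair q.1 q.2) (fun _ => rfl) (fun q => ?_) hG
  obtain ⟨z, r⟩ := q
  simp [hrun]

/-- ACCOUNTING, pointwise in the coins: on input `⟨u, y⟩` with `|u| = |t|`, if `A`'s output has the
prefix `t ++ pad` then the truncation adversary `B` outputs exactly `t`. [folklore] -/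
theorem run_eq_of_prefix {A B : RandAlg (List Bool) (List Bool)}
    (hrun : ∀ z r, B.run z r = (A.run z r).take (fstF z).length) {u y t pad r : List Bool}
    (hu : u.length = t.length) (h : t ++ pad <+: A.run (boolPair u y) r) :
    B.run (boolPair u y) r = t := by
  have ht : t <+: A.run (boolPair u y) r := (List.prefix_append t pad).trans h
  rw [List.prefix_iff_eq_take] at ht
  rw [hrun, fstF_boolPair, hu]
  exact ht.symm

end Bridge

/-- **The generic bridge** (stub `stub_bridge` of line `Sketch`). A one-way function `gen` together
with a map `pre` giving, for every seed, a `gen`-preimage of `gen s` of the seed's length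
(`gen (pre s) = gen s`, `|pre s| = |s| ≤ |gen s|`) which ONE uniform oracle-free Clifford+T family
outputs from `gen s` (zero-padded to `|gen s|`, as a prefix, with probability `≥ 2/3`) witnesses
`WbwThesis`: `ans s := pre s ++ 0^{|gen s|-|s|}` has exact length `X(|gen s|)`, (Q) is the
hypothesis, and (C) holds because a PPT `A` printing `ans s` yields the PPT inverter
"first `n` symbols of `A`'s output" (`n` read off `1ⁿ`; `Bridge.isPPT_of_run_eq_take`) whose
inversion probability dominates `A`'s success seed by seed and coin string by coin string
(`RandAlg.pr_eq_uniformProb`, `Bridge.run_eq_of_prefix`) and is negligible by one-wayness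
(`SuperpolynomialDecay.trans_abs_le`). The conclusion is the body of `WbwThesis`, unfolded.
[cite: Goldreich2001, Def. 2.2.1] -/
theorem stub_bridge {gen pre : List Bool → List Bool} (hgen : IsOneWay gen)
    (hpre : ∀ s, gen (pre s) = gen s) (hlen : ∀ s, (pre s).length = s.length)
    (hle : ∀ s, s.length ≤ (gen s).length)
    (hQ : ∃ F : QCircuitFamily cliffordT, F.IsOracleFree ∧ F.IsUniform ∧
      ∀ s, (2 / 3 : ℝ) ≤ F.kernelProb 0 (gen s)
        {y | pre s ++ List.replicate ((gen s).length - s.length) false <+: y}) :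
    ∃ (gen ans : List Bool → List Bool), Literature.Computability.Complexity.PolyTimeComputable id id gen ∧
      (∃ p : Polynomial ℕ, ∀ s, (ans s).length = p.eval (gen s).length) ∧
      (∃ F : Literature.Computability.Cryptography.QCircuitFamily Literature.Computability.Cryptography.cliffordT,
        F.IsOracleFree ∧ F.IsUniform ∧ ∀ s, 2 / 3 ≤ F.kernelProb 0 (gen s) {y | ans s <+: y}) ∧
      ∀ A : Literature.Computability.Complexity.RandAlg (List Bool) (List Bool),
        Literature.Computability.Cryptography.IsPPT A id →
          Asymptotics.SuperpolynomialDecay atTop (fun n : ℕ => (n : ℝ)) (fun n : ℕ =>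
            Literature.Computability.Cryptography.uniformAvg n fun s =>
              A.pr id (Literature.Computability.Complexity.boolPair (Computability.unaryEncodeNat n) (gen s))
                {y | ans s <+: y}) := by
  refine ⟨gen, fun s => pre s ++ List.replicate ((gen s).length - s.length) false, hgen.1,
    ⟨X, fun s => ?_⟩, hQ, fun A hA => ?_⟩
  · -- |ans s| = |s| + (|gen s| - |s|) = |gen s|
    have h := hle s
    simp only [List.length_append, List.length_replicate, hlen, eval_X]
    omega
  · -- (C): the truncation adversary `B` (anonymous; same coins as `A`)
    obtain ⟨B, hrun, hcoin⟩ : ∃ B : RandAlg (List Bool) (List Bool),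
        (∀ z r, B.run z r = (A.run z r).take (fstF z).length) ∧ B.coinLen = A.coinLen :=
      ⟨⟨fun z r => (A.run z r).take (fstF z).length, A.coinLen⟩, fun _ _ => rfl, rfl⟩
    -- domination by the inversion probability of `B`, which is negligible
    refine (hgen.2 B (Bridge.isPPT_of_run_eq_take hA hrun hcoin)).trans_abs_le fun n => ?_
    rw [abs_of_nonneg (invertProb_nonneg _ _ _),
      abs_of_nonneg (uniformAvg_nonneg fun _ => RandAlg.pr_nonneg _ _ _ _)]
    unfold invertProb uniformAvg
    refine div_le_div_of_nonneg_right (Finset.sum_le_sum fun x _ => ?_) (by positivity)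
    -- same coins: count the coin strings (`RandAlg.pr_eq_uniformProb`) and compare pointwise
    classical
    dsimp only
    rw [RandAlg.pr_eq_uniformProb, RandAlg.pr_eq_uniformProb, hcoin]
    unfold uniformProb
    refine div_le_div_of_nonneg_right ?_ (by positivity)
    exact_mod_cast Finset.card_le_card fun r hr => by
      simp only [Finset.mem_filter, Finset.mem_univ, true_and, Set.mem_setOf_eq] at hr ⊢
      -- `hr`: `A` prints `ans x` as a prefix; goal: `B` prints a `gen`-preimage of `gen x`
      have hu : (unaryEncodeNat n).length = (pre x.toList).length := by
        rw [hlen, x.toList_length]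
        exact unary_decode_encode_nat n
      rw [Bridge.run_eq_of_prefix hrun hu hr, hpre]

end Summit.QuantumAdvantage.QuantumAdvantage.Theorems.WhiteBoxWalk

end
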